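import Literature.Analysis.FunctionSpaces.MaximalLipschitz
import Literature.Analysis.FunctionSpaces.TorusMollifier
import Literature.Analysis.FunctionSpaces.TorusPoincareMorrey
import Mathlib.Analysis.Calculus.BumpFunction.FiniteDimension
import HarnessLib

/-!
# The maximal-function Lipschitz estimate on the flat torus

Analysis/FunctionSpaces support file (everything proved). For a `C¹` map `u : T^d → F` we
construct a majorant `M : T^d → [0, ∞]` with

* `‖u x - u y‖ ≤ C_d · dist x y · (M x + M y)` for all `x, y ∈ T^d`, and
* `∫ M² ≤ C_d · ∫ ‖Du‖²`,

`C_d` depending only on `d` (`Torus.exists_maximal_majorant`). This is the periodic version of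
the pointwise maximal-function estimate `|u(x) - u(y)| ≲ |x - y| (M|Du|(x) + M|Du|(y))` with the
Hardy–Littlewood maximal theorem in `L²` — the Crippa–De Lellis ingredient of the stability
estimates for continuity equations with Sobolev fields (Crippa–De Lellis 2008; Seis 2017/2018),
used in Seis 2022, Lemma 3. Proof: apply the tree's Euclidean estimate
(`Literature.Analysis.FunctionSpaces.enorm_sub_le_maximal`, `MaximalLipschitz`) and maximal
theorem (`Literature.Analysis.SingularIntegrals.lintegral_maximalFunction_rpow_le`) to the
compactly supported `C¹` map `χ • (lift u - ⨍ u)` (`χ` a smooth cutoff equal to one on a large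
ball), transfer `L²` norms between `ℝ^d` and `T^d` through lattice translates of the
fundamental domain, and use Poincaré–Wirtinger on the torus (`Torus.eLpNorm_sub_integral_le`)
for the cutoff-derivative term.

## References

* G. Crippa, C. De Lellis, *Estimates and regularity results for the DiPerna–Lions flow*,
  J. Reine Angew. Math. 616 (2008), 15–46 (the maximal-function Lipschitz estimate).
* C. Seis, Comm. Math. Phys. 399 (2023) (arXiv:2003.08794), Lemma 3. [`Seis2022`]
* E. M. Stein, *Singular integrals and differentiability properties of functions* (1970),
  Ch. I §1. [`Stein1971`]
-/

noncomputable section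

open MeasureTheory Metric Set Filter Topology Module
open scoped ENNReal NNReal

namespace Literature.Analysis.FunctionSpaces

namespace Torus

open Literature.Analysis.SingularIntegrals

variable {d : Type*} [Fintype d] [DecidableEq d]
variable {F : Type*} [NormedAddCommGroup F] [NormedSpace ℝ F]

/-! ## Geometry of the centred representative -/

omit [Fintype d] [DecidableEq d] in
/-- `|reprc z i| = ‖z i‖`: the centred representative realises the quotient norm
coordinatewise. [folklore] -/
theorem abs_reprc_apply_eq_norm (z : UnitAddTorus d) (i : d) : |reprc z i| = ‖z i‖ := by
  have h1 : (((reprc z) i : ℝ) : UnitAddCircle) = z i := by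
    have := congrFun (proj_reprc z) i
    rwa [proj_apply] at this
  rw [← h1, UnitAddCircle.norm_eq, round_eq_zero_iff.2 (reprc_apply_mem_Ico z i)]
  simp

omit [DecidableEq d] in
/-- `‖reprc z‖ ≤ √(card d) · ‖z‖` (Euclidean norm of the centred lift against the quotient sup
norm). [folklore] -/
theorem norm_reprc_le_sqrt_card_mul_norm (z : UnitAddTorus d) :
    ‖reprc z‖ ≤ Real.sqrt (Fintype.card d) * ‖z‖ := by
  rw [EuclideanSpace.norm_eq]
  have h : ∑ i, ‖reprc z i‖ ^ 2 ≤ Fintype.card d * ‖z‖ ^ 2 := by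
    calc ∑ i, ‖reprc z i‖ ^ 2 ≤ ∑ _i : d, ‖z‖ ^ 2 := by
          refine Finset.sum_le_sum fun i _ => ?_
          rw [Real.norm_eq_abs, abs_reprc_apply_eq_norm]
          exact pow_le_pow_left₀ (norm_nonneg _) (norm_le_pi_norm z i) 2
      _ = Fintype.card d * ‖z‖ ^ 2 := by rw [Finset.sum_const, Finset.card_univ, nsmul_eq_mul]
  calc Real.sqrt (∑ i, ‖reprc z i‖ ^ 2) ≤ Real.sqrt (Fintype.card d * ‖z‖ ^ 2) :=
        Real.sqrt_le_sqrt h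
    _ = Real.sqrt (Fintype.card d) * ‖z‖ := by
        rw [Real.sqrt_mul (Nat.cast_nonneg _), Real.sqrt_sq (norm_nonneg _)]

omit [DecidableEq d] in
/-- `‖reprc z‖ ≤ √(card d) / 2`. [folklore] -/
theorem norm_reprc_le_sqrt_card_div_two (z : UnitAddTorus d) :
    ‖reprc z‖ ≤ Real.sqrt (Fintype.card d) / 2 := by
  rw [EuclideanSpace.norm_eq]
  have h : ∑ i, ‖reprc z i‖ ^ 2 ≤ Fintype.card d * (1 / 2) ^ 2 := by
    calc ∑ i, ‖reprc z i‖ ^ 2 ≤ ∑ _i : d, (1 / 2 : ℝ) ^ 2 := by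
          refine Finset.sum_le_sum fun i _ => ?_
          rw [Real.norm_eq_abs]
          exact pow_le_pow_left₀ (abs_nonneg _) (abs_reprc_apply_le z i) 2
      _ = Fintype.card d * (1 / 2) ^ 2 := by rw [Finset.sum_const, Finset.card_univ, nsmul_eq_mul]
  calc Real.sqrt (∑ i, ‖reprc z i‖ ^ 2) ≤ Real.sqrt (Fintype.card d * (1 / 2) ^ 2) :=
        Real.sqrt_le_sqrt h
    _ = Real.sqrt (Fintype.card d) / 2 := by
        rw [Real.sqrt_mul (Nat.cast_nonneg _), Real.sqrt_sq (by norm_num)]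
        ring

/-- Two lifts of the same point differ by a lattice vector with small entries: if
`proj w = y` and `|w i| < 3/2` for all `i`, then `w = reprc y + latticeVec k` with `|k i| ≤ 1`.
[folklore] -/
theorem exists_eq_reprc_add_latticeVec {w : EuclideanSpace ℝ d} {y : UnitAddTorus d}
    (hw : proj w = y) (hsmall : ∀ i, |w i| < 3 / 2) :
    ∃ k : d → ℤ, (∀ i, |k i| ≤ 1) ∧ w = reprc y + latticeVec k := by
  have h := (proj_eq_proj_iff_holds (reprc y) w).1 (by rw [proj_reprc, hw])
  obtain ⟨k, hk⟩ := h
  refine ⟨k, fun i => ?_, hk⟩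
  have hki : (k i : ℝ) = w i - reprc y i := by
    have := congrFun (congrArg (fun v : EuclideanSpace ℝ d => (v : d → ℝ)) hk) i
    simp only [PiLp.add_apply, latticeVec_apply] at this
    change w i = reprc y i + k i at this
    linarith
  have h1 := hsmall i
  have h2 := abs_reprc_apply_le y i
  have h3 : |(k i : ℝ)| < 2 := by
    rw [hki]
    calc |w i - reprc y i| ≤ |w i| + |reprc y i| := abs_sub _ _
      _ < 3 / 2 + 1 / 2 := add_lt_add_of_lt_of_le h1 h2
      _ = 2 := by norm_num
  have h4 : |k i| < 2 := by exact_mod_cast h3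
  omega

/-! ## Lattice translates of the fundamental domain -/

omit [NormedAddCommGroup F] [NormedSpace ℝ F] in
/-- The lift is invariant under lattice translations. [folklore] -/
theorem lift_add_latticeVec (f : UnitAddTorus d → F) (w : EuclideanSpace ℝ d) (k : d → ℤ) :
    lift f (w + latticeVec k) = lift f w := by
  simp [lift]

/-- The integral of a lifted size over a lattice translate of the centred cube is the torus
integral. [folklore] -/
theorem setLIntegral_comp_proj_image_centredCube (f : UnitAddTorus d → ℝ≥0∞) (k : d → ℤ) :
    ∫⁻ w in (fun v => v + latticeVec k) '' centredCube d, f (proj w) = ∫⁻ x, f x := by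
  have hmp : MeasurePreserving (fun v : EuclideanSpace ℝ d => v + latticeVec k) volume volume :=
    measurePreserving_add_right volume _
  have hme : MeasurableEmbedding fun v : EuclideanSpace ℝ d => v + latticeVec k :=
    (Homeomorph.addRight (latticeVec k)).measurableEmbedding
  rw [← hmp.setLIntegral_comp_emb hme]
  simp only [proj_add_latticeVec]
  rw [← lintegral_comp_reprc]
  simp only [proj_reprc]

/-- The lattice points with entries in `[-N, N]`. [folklore] -/
def latticeBox (d : Type*) [Fintype d] [DecidableEq d] (N : ℕ) : Finset (d → ℤ) :=
  Fintype.piFinset fun _ => Finset.Icc (-(N : ℤ)) N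

/-- `#latticeBox N = (2N+1)^d`. [folklore] -/
theorem card_latticeBox (N : ℕ) : (latticeBox d N).card = (2 * N + 1) ^ Fintype.card d := by
  classical
  rw [latticeBox, Fintype.card_piFinset, Finset.prod_const, Finset.card_univ, Int.card_Icc]
  congr 1
  lia

/-- The cube `{|w i| < N + 1/2}` is covered by the lattice translates of the centred cube with
lattice points in the box `[-N, N]^d`. [folklore] -/
theorem subset_biUnion_image_centredCube (N : ℕ) :
    {w : EuclideanSpace ℝ d | ∀ i, |w i| < N + 1 / 2} ⊆
      ⋃ k ∈ latticeBox d N, (fun v => v + latticeVec k) '' centredCube d := by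
  intro w hw
  simp only [mem_setOf_eq] at hw
  set k : d → ℤ := fun i => ⌊w i + 1 / 2⌋ with hk
  have hkbox : k ∈ latticeBox d N := by
    simp only [latticeBox, Fintype.mem_piFinset, Finset.mem_Icc]
    intro i
    have h := hw i
    rw [abs_lt] at h
    change -(N : ℤ) ≤ ⌊w i + 1 / 2⌋ ∧ ⌊w i + 1 / 2⌋ ≤ (N : ℤ)
    constructor
    · refine Int.le_floor.2 ?_
      push_cast
      linarith
    · have : ⌊w i + 1 / 2⌋ < (N : ℤ) + 1 := by
        refine Int.floor_lt.2 ?_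
        push_cast
        linarith
      omega
  refine mem_iUnion₂.2 ⟨k, hkbox, ⟨w - latticeVec k, fun i => ?_, by simp⟩⟩
  simp only [PiLp.sub_apply, latticeVec_apply, mem_Ico]
  have h1 := Int.floor_le (w i + 1 / 2)
  have h2 := Int.lt_floor_add_one (w i + 1 / 2)
  have hki : ((k i : ℤ) : ℝ) = ⌊w i + 1 / 2⌋ := by simp [hk]
  rw [hki]
  constructor <;> linarith

/-- **Integrals of periodic sizes over big cubes**: for a measurable `f : T^d → [0,∞]`,
`∫_{|w i| < N + 1/2} f (proj w) dw ≤ (2N+1)^d ∫_{T^d} f`. [folklore] -/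
theorem setLIntegral_comp_proj_le_card_mul (f : UnitAddTorus d → ℝ≥0∞) (N : ℕ) :
    ∫⁻ w in {w : EuclideanSpace ℝ d | ∀ i, |w i| < N + 1 / 2}, f (proj w) ≤
      (2 * N + 1) ^ Fintype.card d * ∫⁻ x, f x := by
  calc ∫⁻ w in {w : EuclideanSpace ℝ d | ∀ i, |w i| < N + 1 / 2}, f (proj w)
      ≤ ∫⁻ w in ⋃ k ∈ latticeBox d N, (fun v => v + latticeVec k) '' centredCube d, f (proj w) :=
        lintegral_mono_set (subset_biUnion_image_centredCube N)
    _ = ∫⁻ w in ⋃ k : latticeBox d N, (fun v => v + latticeVec (k : d → ℤ)) '' centredCube d,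
          f (proj w) := by
        rw [← Finset.set_biUnion_coe, Set.biUnion_eq_iUnion]
        rfl
    _ ≤ ∑' k : latticeBox d N, ∫⁻ w in (fun v => v + latticeVec (k : d → ℤ)) '' centredCube d,
          f (proj w) := lintegral_iUnion_le _ _
    _ = ∑ k ∈ latticeBox d N, ∫⁻ x, f x := by
        rw [tsum_fintype,
          Finset.sum_coe_sort (latticeBox d N) (fun k => ∫⁻ w in
            (fun v => v + latticeVec k) '' centredCube d, f (proj w))]
        refine Finset.sum_congr rfl fun k _ => ?_
        exact setLIntegral_comp_proj_image_centredCube f k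
    _ = (2 * N + 1) ^ Fintype.card d * ∫⁻ x, f x := by
        rw [Finset.sum_const, card_latticeBox, nsmul_eq_mul]
        push_cast
        ring

omit [DecidableEq d] in
/-- A ball of radius `N` around the origin lies in the cube `{|w i| < N + 1/2}`. [folklore] -/
theorem ball_subset_setOf_abs_lt (N : ℕ) :
    ball (0 : EuclideanSpace ℝ d) N ⊆ {w : EuclideanSpace ℝ d | ∀ i, |w i| < N + 1 / 2} := by
  intro w hw i
  rw [mem_ball_zero_iff] at hw
  have := (abs_apply_le_norm w i).trans_lt hw
  linarith

/-! ## Squares of finite sums in `ℝ≥0∞` -/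

omit [Fintype d] [DecidableEq d] in
/-- `(∑_{k ∈ K} a k)² ≤ 2 #K ∑_{k ∈ K} (a k)²` in `ℝ≥0∞` (a crude Cauchy–Schwarz). [folklore] -/
theorem sq_sum_le_two_mul_card_mul_sum_sq {ι : Type*} (K : Finset ι) (a : ι → ℝ≥0∞) :
    (∑ k ∈ K, a k) ^ 2 ≤ 2 * K.card * ∑ k ∈ K, a k ^ 2 := by
  have hab : ∀ x y : ℝ≥0∞, x * y ≤ x ^ 2 + y ^ 2 := fun x y => by
    rcases le_total x y with h | h
    · calc x * y ≤ y * y := mul_le_mul' h le_rfl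
        _ = y ^ 2 := (sq y).symm
        _ ≤ x ^ 2 + y ^ 2 := le_add_self
    · calc x * y ≤ x * x := mul_le_mul' le_rfl h
        _ = x ^ 2 := (sq x).symm
        _ ≤ x ^ 2 + y ^ 2 := le_self_add
  calc (∑ k ∈ K, a k) ^ 2 = ∑ k ∈ K, ∑ j ∈ K, a k * a j := by rw [sq, Finset.sum_mul_sum]
    _ ≤ ∑ k ∈ K, ∑ j ∈ K, (a k ^ 2 + a j ^ 2) :=
        Finset.sum_le_sum fun k _ => Finset.sum_le_sum fun j _ => hab _ _
    _ = ∑ k ∈ K, (K.card * a k ^ 2 + ∑ j ∈ K, a j ^ 2) := by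
        refine Finset.sum_congr rfl fun k _ => ?_
        rw [Finset.sum_add_distrib, Finset.sum_const, nsmul_eq_mul]
    _ = ∑ k ∈ K, K.card * a k ^ 2 + K.card * ∑ j ∈ K, a j ^ 2 := by
        rw [Finset.sum_add_distrib, Finset.sum_const, nsmul_eq_mul]
    _ = 2 * K.card * ∑ k ∈ K, a k ^ 2 := by rw [← Finset.mul_sum]; ring

/-! ## The main estimate -/

variable [CompleteSpace F]

omit [DecidableEq d] [CompleteSpace F] in
/-- The `L²` mass of a translate of a size over the torus is at most its total mass on `ℝ^d`:
`∫_{T^d} G(reprc x + c)² dx ≤ ∫_{ℝ^d} G²`. [folklore] -/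
theorem lintegral_comp_reprc_add_le (G : EuclideanSpace ℝ d → ℝ≥0∞) (c : EuclideanSpace ℝ d) :
    ∫⁻ x : UnitAddTorus d, G (reprc x + c) ≤ ∫⁻ w, G w := by
  rw [lintegral_comp_reprc (fun v => G (v + c))]
  calc ∫⁻ v in centredCube d, G (v + c) ≤ ∫⁻ v, G (v + c) := setLIntegral_le_lintegral _ _
    _ = ∫⁻ w, G w := lintegral_add_right_eq_self G c

omit [Fintype d] [DecidableEq d] in
/-- `(a + b)² ≤ 2a² + 2b²` in `ℝ≥0∞`. [folklore] -/
theorem ennreal_add_sq_le (a b : ℝ≥0∞) : (a + b) ^ 2 ≤ 2 * a ^ 2 + 2 * b ^ 2 := by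
  rcases eq_or_ne a ⊤ with rfl | ha
  · simp
  rcases eq_or_ne b ⊤ with rfl | hb
  · simp
  lift a to ℝ≥0 using ha
  lift b to ℝ≥0 using hb
  have h : ((a + b) ^ 2 : ℝ≥0) ≤ 2 * a ^ 2 + 2 * b ^ 2 := by
    rw [← NNReal.coe_le_coe]
    push_cast
    nlinarith [sq_nonneg ((a : ℝ) - b)]
  exact_mod_cast h

omit [Fintype d] [DecidableEq d] in
/-- `‖f‖²_{L²(μ)} = ∫ ‖f‖²` in `ℝ≥0∞`. [folklore] -/
theorem eLpNorm_two_sq' {α : Type*} [MeasurableSpace α] {G : Type*} [NormedAddCommGroup G]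
    (f : α → G) (μ : Measure α) : eLpNorm f 2 μ ^ 2 = ∫⁻ x, ‖f x‖ₑ ^ 2 ∂μ := by
  have h2 : (2 : ℝ≥0∞).toReal = 2 := by norm_num
  rw [eLpNorm_eq_lintegral_rpow_enorm_toReal two_ne_zero ENNReal.ofNat_ne_top, h2,
    ← ENNReal.rpow_natCast, ← ENNReal.rpow_mul]
  norm_num

omit [DecidableEq d] [CompleteSpace F] in
/-- The torus derivative of a `C¹` map is continuous. [folklore] -/
theorem continuous_fderiv_of_isContDiff_one {f : UnitAddTorus d → F} (hf : IsContDiff 1 f) :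
    Continuous (Torus.fderiv f) := by
  have h : lift (Torus.fderiv f) = _root_.fderiv ℝ (lift f) := funext fun y => (fderiv_lift f y).symm
  rw [← continuous_lift_iff, h]
  exact ContDiff.continuous_fderiv hf one_ne_zero

omit [DecidableEq d] [CompleteSpace F] in
/-- For `w ∉ closedBall 0 r ⊇ tsupport g`, `fderiv g w = 0`. [folklore] -/
theorem fderiv_eq_zero_of_tsupport_subset {g : EuclideanSpace ℝ d → F} {r : ℝ}
    (hg : tsupport g ⊆ closedBall 0 r) {w : EuclideanSpace ℝ d} (hw : w ∉ closedBall (0 : _) r) :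
    _root_.fderiv ℝ g w = 0 := by
  have : w ∉ Function.support (_root_.fderiv ℝ g) := fun h => hw (hg (support_fderiv_subset ℝ h))
  simpa [Function.mem_support] using this

/-- **The maximal-function Lipschitz estimate on `T^d`.** There is a constant `C = C(d) < ∞`
such that every `C¹` map `u : T^d → F` admits a measurable majorant `M : T^d → [0, ∞]` with
`‖u x - u y‖ ≤ C · dist x y · (M x + M y)` for all `x, y` and `∫ M² ≤ C ∫ ‖Du‖²`
(Crippa–De Lellis 2008, the maximal-function estimate; Stein 1970, Ch. I §1 for the maximal
theorem; here obtained from the Euclidean version of the tree applied to a cut-off of the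
periodic lift minus its mean). [cite: Stein1971, Ch. I §1.3 Theorem 1 (c)] -/
theorem exists_maximal_majorant (d : Type*) [Fintype d] [DecidableEq d]
    (F : Type*) [NormedAddCommGroup F] [NormedSpace ℝ F] [CompleteSpace F] :
    ∃ C : ℝ≥0∞, C ≠ ⊤ ∧ ∀ u : UnitAddTorus d → F, IsContDiff 1 u →
      ∃ M : UnitAddTorus d → ℝ≥0∞, Measurable M ∧
        (∀ x y, ‖u x - u y‖ₑ ≤ C * ENNReal.ofReal (dist x y) * (M x + M y)) ∧
        ∫⁻ x, M x ^ 2 ≤ C * ∫⁻ x, ‖Torus.fderiv u x‖ₑ ^ 2 := by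
  set n : ℕ := Fintype.card d with hn
  -- the cutoff
  let χ : ContDiffBump (0 : EuclideanSpace ℝ d) := ⟨Real.sqrt n + 1, Real.sqrt n + 2,
    by positivity, by linarith⟩
  have hχ1 : ∀ w : EuclideanSpace ℝ d, ‖w‖ ≤ Real.sqrt n → χ w = 1 := fun w hw =>
    χ.one_of_mem_closedBall (by rw [mem_closedBall, dist_zero_right]; change ‖w‖ ≤ Real.sqrt n + 1; linarith)
  have hχc : ContDiff ℝ 1 (χ : EuclideanSpace ℝ d → ℝ) := χ.contDiff
  have hχsupp : tsupport (χ : EuclideanSpace ℝ d → ℝ) = closedBall 0 (Real.sqrt n + 2) := χ.tsupport_eq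
  obtain ⟨Kχ, hKχ⟩ : ∃ K, ∀ w, ‖_root_.fderiv ℝ (χ : EuclideanSpace ℝ d → ℝ) w‖ ≤ K :=
    (χ.hasCompactSupport.fderiv (𝕜 := ℝ)).exists_bound_of_continuous
      (hχc.continuous_fderiv one_ne_zero)
  have hKχ0 : 0 ≤ Kχ := (norm_nonneg _).trans (hKχ 0)
  -- the constants
  set N : ℕ := n + 3 with hN
  set Cmax : ℝ≥0∞ := ENNReal.ofReal 2 * (2 * 5 ^ finrank ℝ (EuclideanSpace ℝ d)) *
    ((2 : ℝ≥0∞) ^ ((2 : ℝ) - 1) / ENNReal.ofReal (2 - 1)) with hCmax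
  have hCmax_top : Cmax < ⊤ := maximalLpConst_lt_top _ one_lt_two
  set CL : ℝ≥0∞ := Cmax * (2 * (2 * N + 1) ^ n * (1 + ENNReal.ofReal (Kχ ^ 2) * (n : ℝ≥0∞) ^ 2))
    with hCL
  set Cpt : ℝ≥0∞ := 2 ^ (2 * finrank ℝ (EuclideanSpace ℝ d) + 5) * ENNReal.ofReal (Real.sqrt n)
    with hCpt
  set Cint : ℝ≥0∞ := 2 * (latticeBox d 1).card * ((latticeBox d 1).card * CL) with hCint
  refine ⟨max Cpt Cint, ?_, fun u hu => ?_⟩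
  · refine (max_lt ?_ ?_).ne
    · rw [hCpt]; finiteness
    · have h1 : CL < ⊤ := by
        rw [hCL]
        exact ENNReal.mul_lt_top hCmax_top (by finiteness)
      rw [hCint]
      exact ENNReal.mul_lt_top (by finiteness) (ENNReal.mul_lt_top (by finiteness) h1)
  -- the cut-off lift
  set ubar : F := ∫ x, u x with hubar
  set v : EuclideanSpace ℝ d → F := fun w => χ w • (lift u w - ubar) with hv
  have hlift : ContDiff ℝ 1 (lift u) := hu
  have hvC : ContDiff ℝ 1 v := hχc.smul (hlift.sub contDiff_const)
  have hv_eq : ∀ w : EuclideanSpace ℝ d, ‖w‖ ≤ Real.sqrt n → v w = lift u w - ubar := fun w hw => by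
    simp only [hv, hχ1 w hw, one_smul]
  -- derivative bound for `v`
  have hDv : ∀ w, ‖_root_.fderiv ℝ v w‖ₑ ≤
      (closedBall (0 : EuclideanSpace ℝ d) (Real.sqrt n + 2)).indicator
        (fun w => ‖Torus.fderiv u (proj w)‖ₑ + ENNReal.ofReal Kχ * ‖lift u w - ubar‖ₑ) w := by
    intro w
    by_cases hw : w ∈ closedBall (0 : EuclideanSpace ℝ d) (Real.sqrt n + 2)
    · rw [indicator_of_mem hw]
      have hd : _root_.fderiv ℝ v w = χ w • _root_.fderiv ℝ (fun w => lift u w - ubar) w +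
          (_root_.fderiv ℝ (χ : EuclideanSpace ℝ d → ℝ) w).smulRight (lift u w - ubar) :=
        fderiv_smul (hχc.differentiable one_ne_zero w) ((hlift.sub contDiff_const).differentiable one_ne_zero w)
      rw [hd, fderiv_sub_const, fderiv_lift]
      calc ‖χ w • Torus.fderiv u (proj w) +
            (_root_.fderiv ℝ (χ : EuclideanSpace ℝ d → ℝ) w).smulRight (lift u w - ubar)‖ₑ
          ≤ ‖χ w • Torus.fderiv u (proj w)‖ₑ +
            ‖(_root_.fderiv ℝ (χ : EuclideanSpace ℝ d → ℝ) w).smulRight (lift u w - ubar)‖ₑ := by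
            rw [← ofReal_norm, ← ofReal_norm, ← ofReal_norm,
              ← ENNReal.ofReal_add (norm_nonneg _) (norm_nonneg _)]
            exact ENNReal.ofReal_le_ofReal (norm_add_le _ _)
        _ ≤ ‖Torus.fderiv u (proj w)‖ₑ + ENNReal.ofReal Kχ * ‖lift u w - ubar‖ₑ := by
            gcongr
            · rw [enorm_smul]
              calc ‖χ w‖ₑ * ‖Torus.fderiv u (proj w)‖ₑ ≤ 1 * ‖Torus.fderiv u (proj w)‖ₑ := by
                    gcongr
                    rw [← ofReal_norm, Real.norm_eq_abs, abs_of_nonneg χ.nonneg]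
                    exact ENNReal.ofReal_le_one.2 χ.le_one
                _ = _ := one_mul _
            · rw [← ofReal_norm, ContinuousLinearMap.norm_smulRight_apply, ENNReal.ofReal_mul (norm_nonneg _),
                ← ofReal_norm (lift u w - ubar)]
              gcongr
              exact hKχ w
    · rw [indicator_of_notMem hw]
      have htsupp : tsupport v ⊆ closedBall 0 (Real.sqrt n + 2) := by
        rw [← hχsupp]
        exact tsupport_smul_subset_left _ _
      rw [fderiv_eq_zero_of_tsupport_subset htsupp hw, ← ofReal_norm, norm_zero, ENNReal.ofReal_zero]
  -- the Euclidean maximal function of `‖Dv‖` and its `L²` bound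
  set M' : EuclideanSpace ℝ d → ℝ≥0∞ := maximalFunction volume (fun w => ‖_root_.fderiv ℝ v w‖ₑ)
    with hM'
  have hM'meas : Measurable M' := measurable_maximalFunction volume _
  have hDu_meas : Measurable fun x : UnitAddTorus d => ‖Torus.fderiv u x‖ₑ ^ 2 :=
    (continuous_fderiv_of_isContDiff_one hu).measurable.enorm.pow_const 2
  have hL2E : ∫⁻ w, M' w ^ 2 ≤ CL * ∫⁻ x, ‖Torus.fderiv u x‖ₑ ^ 2 := by
    -- maximal theorem
    have h1 : ∫⁻ w, M' w ^ 2 ≤ Cmax * ∫⁻ w, ‖_root_.fderiv ℝ v w‖ₑ ^ 2 := by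
      have h := lintegral_maximalFunction_rpow_le (μ := volume) (p := 2)
        ((hvC.continuous_fderiv one_ne_zero).measurable.enorm.aemeasurable) one_lt_two
      simp only [ENNReal.rpow_two] at h
      exact h
    -- the size bound, integrated
    have h2 : ∫⁻ w, ‖_root_.fderiv ℝ v w‖ₑ ^ 2 ≤
        2 * ((2 * N + 1) ^ n * ∫⁻ x, ‖Torus.fderiv u x‖ₑ ^ 2) +
        2 * (ENNReal.ofReal (Kχ ^ 2) * ((2 * N + 1) ^ n * ∫⁻ x, ‖u x - ubar‖ₑ ^ 2)) := by
      have hsq : ∀ w, ‖_root_.fderiv ℝ v w‖ₑ ^ 2 ≤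
          (closedBall (0 : EuclideanSpace ℝ d) (Real.sqrt n + 2)).indicator
            (fun w => 2 * ‖Torus.fderiv u (proj w)‖ₑ ^ 2 +
              2 * (ENNReal.ofReal (Kχ ^ 2) * ‖lift u w - ubar‖ₑ ^ 2)) w := by
        intro w
        have h := hDv w
        by_cases hw : w ∈ closedBall (0 : EuclideanSpace ℝ d) (Real.sqrt n + 2)
        · rw [indicator_of_mem hw] at h ⊢
          calc ‖_root_.fderiv ℝ v w‖ₑ ^ 2
              ≤ (‖Torus.fderiv u (proj w)‖ₑ + ENNReal.ofReal Kχ * ‖lift u w - ubar‖ₑ) ^ 2 :=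
                pow_le_pow_left' h 2
            _ ≤ 2 * ‖Torus.fderiv u (proj w)‖ₑ ^ 2 + 2 * (ENNReal.ofReal Kχ * ‖lift u w - ubar‖ₑ) ^ 2 :=
                ennreal_add_sq_le _ _
            _ = _ := by rw [mul_pow, ← ENNReal.ofReal_pow hKχ0]
        · rw [indicator_of_notMem hw] at h ⊢
          exact (pow_le_pow_left' h 2).trans (by simp)
      have hball : closedBall (0 : EuclideanSpace ℝ d) (Real.sqrt n + 2) ⊆
          {w : EuclideanSpace ℝ d | ∀ i, |w i| < N + 1 / 2} := by
        refine (closedBall_subset_ball ?_).trans (ball_subset_setOf_abs_lt N)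
        rw [hN]
        push_cast
        have : Real.sqrt n ≤ n := by
          rcases Nat.eq_zero_or_pos n with h0 | hpos
          · simp [h0]
          · rw [Real.sqrt_le_left (Nat.cast_nonneg _)]
            have : (1 : ℝ) ≤ n := by exact_mod_cast hpos
            nlinarith
        linarith
      calc ∫⁻ w, ‖_root_.fderiv ℝ v w‖ₑ ^ 2
          ≤ ∫⁻ w, (closedBall (0 : EuclideanSpace ℝ d) (Real.sqrt n + 2)).indicator
              (fun w => 2 * ‖Torus.fderiv u (proj w)‖ₑ ^ 2 +
                2 * (ENNReal.ofReal (Kχ ^ 2) * ‖lift u w - ubar‖ₑ ^ 2)) w := lintegral_mono hsq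
        _ = ∫⁻ w in closedBall (0 : EuclideanSpace ℝ d) (Real.sqrt n + 2),
              (2 * ‖Torus.fderiv u (proj w)‖ₑ ^ 2 +
                2 * (ENNReal.ofReal (Kχ ^ 2) * ‖lift u w - ubar‖ₑ ^ 2)) :=
            lintegral_indicator measurableSet_closedBall _
        _ ≤ ∫⁻ w in {w : EuclideanSpace ℝ d | ∀ i, |w i| < N + 1 / 2},
              (2 * ‖Torus.fderiv u (proj w)‖ₑ ^ 2 +
                2 * (ENNReal.ofReal (Kχ ^ 2) * ‖lift u w - ubar‖ₑ ^ 2)) :=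
            lintegral_mono_set hball
        _ = 2 * (∫⁻ w in {w : EuclideanSpace ℝ d | ∀ i, |w i| < N + 1 / 2},
              ‖Torus.fderiv u (proj w)‖ₑ ^ 2) +
            2 * (ENNReal.ofReal (Kχ ^ 2) * ∫⁻ w in {w : EuclideanSpace ℝ d | ∀ i, |w i| < N + 1 / 2},
              ‖lift u w - ubar‖ₑ ^ 2) := by
            have hm1 : Measurable fun w : EuclideanSpace ℝ d => ‖Torus.fderiv u (proj w)‖ₑ ^ 2 :=
              hDu_meas.comp measurable_proj
            have hm2 : Measurable fun w : EuclideanSpace ℝ d => ‖lift u w - ubar‖ₑ ^ 2 :=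
              ((hu.continuous.comp continuous_proj).sub continuous_const).enorm.measurable.pow_const 2
            rw [lintegral_add_left (hm1.const_mul _), lintegral_const_mul _ hm1,
              lintegral_const_mul _ (hm2.const_mul _), lintegral_const_mul _ hm2]
        _ ≤ _ := by
            gcongr
            · exact setLIntegral_comp_proj_le_card_mul (fun x => ‖Torus.fderiv u x‖ₑ ^ 2) N
            · exact setLIntegral_comp_proj_le_card_mul (fun x => ‖u x - ubar‖ₑ ^ 2) N
    -- Poincaré on the torus for the mean-free term
    have h3 : ∫⁻ x, ‖u x - ubar‖ₑ ^ 2 ≤ (n : ℝ≥0∞) ^ 2 * ∫⁻ x, ‖Torus.fderiv u x‖ₑ ^ 2 := by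
      have hP := eLpNorm_sub_integral_le hu (p := 2) one_le_two ENNReal.ofNat_ne_top
      have e1 : ∫⁻ x, ‖u x - ubar‖ₑ ^ 2 = eLpNorm (fun x => u x - ∫ z, u z) 2 volume ^ 2 := by
        rw [← hubar, eLpNorm_two_sq']
      have e2 : ∫⁻ x, ‖Torus.fderiv u x‖ₑ ^ 2 = eLpNorm (fun x => ‖Torus.fderiv u x‖) 2 volume ^ 2 := by
        rw [eLpNorm_two_sq']
        simp_rw [enorm_norm]
      rw [e1, e2, ← mul_pow]
      exact pow_le_pow_left' hP 2
    calc ∫⁻ w, M' w ^ 2 ≤ Cmax * ∫⁻ w, ‖_root_.fderiv ℝ v w‖ₑ ^ 2 := h1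
      _ ≤ Cmax * (2 * ((2 * N + 1) ^ n * ∫⁻ x, ‖Torus.fderiv u x‖ₑ ^ 2) +
          2 * (ENNReal.ofReal (Kχ ^ 2) * ((2 * N + 1) ^ n * ∫⁻ x, ‖u x - ubar‖ₑ ^ 2))) :=
          mul_le_mul' le_rfl h2
      _ ≤ Cmax * (2 * ((2 * N + 1) ^ n * ∫⁻ x, ‖Torus.fderiv u x‖ₑ ^ 2) +
          2 * (ENNReal.ofReal (Kχ ^ 2) * ((2 * N + 1) ^ n * ((n : ℝ≥0∞) ^ 2 *
            ∫⁻ x, ‖Torus.fderiv u x‖ₑ ^ 2)))) := by gcongr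
      _ = CL * ∫⁻ x, ‖Torus.fderiv u x‖ₑ ^ 2 := by rw [hCL]; ring
  -- the periodised majorant
  set M : UnitAddTorus d → ℝ≥0∞ := fun x => ∑ k ∈ latticeBox d 1, M' (reprc x + latticeVec k)
    with hM
  have hMmeas : Measurable M := Finset.measurable_sum _ fun k _ =>
    hM'meas.comp (measurable_reprc.add_const _)
  refine ⟨M, hMmeas, fun x y => ?_, ?_⟩
  · -- pointwise estimate
    set xl : EuclideanSpace ℝ d := reprc x with hxl
    set z : EuclideanSpace ℝ d := reprc (y - x) with hz
    set yl : EuclideanSpace ℝ d := xl + z with hyl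
    have hxn : ‖xl‖ ≤ Real.sqrt n / 2 := norm_reprc_le_sqrt_card_div_two x
    have hzn : ‖z‖ ≤ Real.sqrt n / 2 := norm_reprc_le_sqrt_card_div_two (y - x)
    have hyn : ‖yl‖ ≤ Real.sqrt n :=
      (norm_add_le _ _).trans (by linarith)
    have hsqrt0 : 0 ≤ Real.sqrt n := Real.sqrt_nonneg _
    have hux : v xl = u x - ubar := by
      rw [hv_eq xl (by linarith), lift_apply, hxl, proj_reprc]
    have huy : v yl = u y - ubar := by
      rw [hv_eq yl hyn, lift_apply, hyl, hxl, hz, proj_add, proj_reprc, proj_reprc, add_sub_cancel]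
    have hpt := enorm_sub_le_maximal volume hvC xl yl
    rw [hux, huy, sub_sub_sub_cancel_right] at hpt
    have hdist : ‖xl - yl‖ ≤ Real.sqrt n * dist x y := by
      rw [hyl, sub_add_cancel_left, norm_neg, hz, dist_comm, dist_eq_norm]
      exact norm_reprc_le_sqrt_card_mul_norm (y - x)
    have hMx : M' xl ≤ M x := by
      have : M' xl = M' (reprc x + latticeVec 0) := by rw [latticeVec_zero, add_zero]
      rw [this]
      exact Finset.single_le_sum (f := fun k => M' (reprc x + latticeVec k)) (fun _ _ => bot_le)
        (by simp [latticeBox])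
    have hMy : M' yl ≤ M y := by
      have hsmall : ∀ i, |yl i| < 3 / 2 := fun i => by
        rw [hyl, PiLp.add_apply]
        calc |xl i + z i| ≤ |xl i| + |z i| := abs_add_le _ _
          _ ≤ 1 / 2 + 1 / 2 := add_le_add (abs_reprc_apply_le x i) (abs_reprc_apply_le _ i)
          _ < 3 / 2 := by norm_num
      have hproj : proj yl = y := by
        rw [hyl, hxl, hz, proj_add, proj_reprc, proj_reprc, add_sub_cancel]
      obtain ⟨k, hk1, hk⟩ := exists_eq_reprc_add_latticeVec hproj hsmall
      rw [hk]
      refine Finset.single_le_sum (f := fun k => M' (reprc y + latticeVec k)) (fun _ _ => bot_le) ?_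
      simp only [latticeBox, Fintype.mem_piFinset, Finset.mem_Icc]
      intro i
      have := hk1 i
      rw [abs_le] at this
      exact_mod_cast this
    calc ‖u x - u y‖ₑ ≤ 2 ^ (2 * finrank ℝ (EuclideanSpace ℝ d) + 5) * ENNReal.ofReal ‖xl - yl‖ *
          (M' xl + M' yl) := hpt
      _ ≤ 2 ^ (2 * finrank ℝ (EuclideanSpace ℝ d) + 5) * ENNReal.ofReal (Real.sqrt n * dist x y) *
          (M x + M y) := by gcongr
      _ = Cpt * ENNReal.ofReal (dist x y) * (M x + M y) := by
          rw [hCpt, ENNReal.ofReal_mul hsqrt0]; ring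
      _ ≤ max Cpt Cint * ENNReal.ofReal (dist x y) * (M x + M y) := by
          gcongr; exact le_max_left _ _
  · -- the `L²` bound of the majorant
    calc ∫⁻ x, M x ^ 2 ≤ ∫⁻ x, 2 * (latticeBox d 1).card *
          ∑ k ∈ latticeBox d 1, M' (reprc x + latticeVec k) ^ 2 :=
          lintegral_mono fun x => sq_sum_le_two_mul_card_mul_sum_sq _ _
      _ = 2 * (latticeBox d 1).card * ∑ k ∈ latticeBox d 1, ∫⁻ x, M' (reprc x + latticeVec k) ^ 2 := by
          have hmk : ∀ k : d → ℤ, Measurable fun x : UnitAddTorus d => M' (reprc x + latticeVec k) ^ 2 :=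
            fun k => (hM'meas.comp (measurable_reprc.add_const _)).pow_const 2
          rw [lintegral_const_mul _ (Finset.measurable_sum (latticeBox d 1)
              (f := fun k x => M' (reprc x + latticeVec k) ^ 2) fun k _ => hmk k),
            lintegral_finsetSum _ fun k _ => hmk k]
      _ ≤ 2 * (latticeBox d 1).card * ∑ _k ∈ latticeBox d 1, ∫⁻ w, M' w ^ 2 := by
          gcongr with k
          exact lintegral_comp_reprc_add_le (fun w => M' w ^ 2) _
      _ ≤ 2 * (latticeBox d 1).card * ((latticeBox d 1).card * (CL * ∫⁻ x, ‖Torus.fderiv u x‖ₑ ^ 2)) := by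
          rw [Finset.sum_const, nsmul_eq_mul]
          gcongr
      _ = Cint * ∫⁻ x, ‖Torus.fderiv u x‖ₑ ^ 2 := by rw [hCint]; ring
      _ ≤ max Cpt Cint * ∫⁻ x, ‖Torus.fderiv u x‖ₑ ^ 2 := by gcongr; exact le_max_right _ _

end Torus

end Literature.Analysis.FunctionSpaces
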